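import Mathlib.Analysis.RCLike.Basic
import Mathlib.Algebra.Order.Archimedean.Real.Hom
import Mathlib.Analysis.Complex.Basic
import Mathlib.Analysis.Complex.Circle
import Mathlib.Analysis.SpecialFunctions.Pow.Real
import Mathlib.Algebra.Order.Positive.Field
import Mathlib.Topology.Algebra.Field
import Mathlib.Topology.Connected.Clopen
import Mathlib.GroupTheory.QuotientGroup.Basic
import Mathlib.LinearAlgebra.FiniteDimensional.Defs
import HarnessLib

/-!
# Frobenioids II, Definition 3.1 (i)–(iv): archimedean local fields and angular regions

Mochizuki, *The geometry of Frobenioids II*, Kyushu J. Math. **62** (2008) 401–460, §3 "Archimedean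
Primes", Definition 3.1 (i)–(iv), author's text pp. 23–24 [cite: MochizukiFrdII2008, Def 3.1 pp.23-24]:
archimedean local fields (real / complex), the group of units `O_K^× ⊆ K^×` of elements of norm `1`,
`S¹ := O_ℂ^×`, `ord(K^×) := K^×/O_K^× ≅ ℝ_{>0}`, the canonical decomposition
`O_K^× × ord(K^×) ≃ K^×`, angular regions `A = B × C ⊆ K^×` with their tips, boundaries,
isotropic / co-angular angular regions, angular regions of `K` and of one-dimensional `K`-vector
spaces, tensor products of angular regions, and base change `(V_K, A_K)|_L` (iv).

**Dictionary.** Items (ii)–(iv) only use that `K` is `ℝ` or `ℂ` with its absolute value; we type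
them over Mathlib's `RCLike K` (which is exactly "`ℝ` or `ℂ` as a normed field"), so
`O_K^× = normOneSubgroup K`, `ord(K^×) = OrdArch K := Kˣ ⧸ O_K^×`, `ℝ_{>0} = {x : ℝ // 0 < x}`.
Item (i) (archimedean local fields as topological fields, their automorphisms and inclusions) is
typed for a topological field `K`. An angular region is recorded as the DATA `(B, λ)` of the
printed product decomposition `A = B × (0, λ]` (`AngularRegion`), with `carrier` the subset
`A ⊆ K^×`; this is equivalent to the printed "subset of the form `B × C`" since `B` and `λ` are
recovered from `A` as its projection to `O_K^×` and the supremum of `|A|`.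

**Contents / claims.** The canonical decomposition is PROVED to be a group isomorphism
(`unitDecomposition`), `ord(K^×) ≅ ℝ_{>0}` is PROVED (`ordArchEquiv`), "`B = O_K^×` whenever `K` is
real" and "∂A maps bijectively to `B`" are PROVED; the automorphism statements of (i) are Mathlib
(`Real.RingHom.unique`, `Complex.ringHom_eq_id_or_conj_of_continuous`) and are quoted as theorems;
the inclusion statement of (i), the tensor-product statement of (iii) and base change (iv) are named
facts / definitions quoting print. Deliberately NOT here: Def. 3.1 (v) (real/complex objects of a
category over `D₀`, complexifiable, RC-connected, RC-anchors, RC-standard type) — it needs the base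
category `D₀` of §3 and is typed with it (`ArchimedeanBase.lean`).
-/

namespace Literature.AlgebraicGeometry.Frobenioids

open Function Set Topology
open scoped Pointwise

noncomputable section

namespace ArchFrd

/-! ### Definition 3.1 (i): archimedean local fields -/

section LocalField

variable (K : Type*) [Field K] [TopologicalSpace K]

/-- **Definition 3.1 (i)** (FrdII p. 23): `K` is a *real* archimedean local field if it is isomorphic,
as a topological field, to `ℝ`. [cite: MochizukiFrdII2008, Def 3.1 (i) p.23] -/
@[mk_iff] structure IsRealLocalField : Prop where
  /-- a bicontinuous field isomorphism with `ℝ` exists -/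
  exists_equiv : ∃ e : K ≃+* ℝ, Continuous e ∧ Continuous e.symm

/-- **Definition 3.1 (i)** (FrdII p. 23): `K` is a *complex* archimedean local field if it is
isomorphic, as a topological field, to `ℂ`. [cite: MochizukiFrdII2008, Def 3.1 (i) p.23] -/
@[mk_iff] structure IsComplexLocalField : Prop where
  /-- a bicontinuous field isomorphism with `ℂ` exists -/
  exists_equiv : ∃ e : K ≃+* ℂ, Continuous e ∧ Continuous e.symm

/-- **Definition 3.1 (i)** (FrdII p. 23): "An *archimedean local field* is defined to be a topological
field that is isomorphic [as a topological field] to either … `ℝ` … or … `ℂ`."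
[cite: MochizukiFrdII2008, Def 3.1 (i) p.23] -/
def IsArchLocalField : Prop := IsRealLocalField K ∨ IsComplexLocalField K

/-- **Definition 3.1 (i)** (FrdII p. 23): "the topological field `ℝ` has no nontrivial automorphisms"
— indeed `ℝ` has no nontrivial ring endomorphisms at all (Mathlib). [cite: MochizukiFrdII2008, Def 3.1 (i) p.23] -/
theorem real_ringHom_eq_id (f : ℝ →+* ℝ) : f = RingHom.id ℝ := Subsingleton.elim _ _

/-- **Definition 3.1 (i)** (FrdII p. 23): "the unique nontrivial automorphism of the topological field
`ℂ` is given by complex conjugation" — a continuous ring endomorphism of `ℂ` is the identity or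
conjugation (Mathlib). [cite: MochizukiFrdII2008, Def 3.1 (i) p.23] -/
theorem complex_continuous_ringHom (f : ℂ →+* ℂ) (hf : Continuous f) :
    f = RingHom.id ℂ ∨ f = starRingEnd ℂ :=
  Complex.ringHom_eq_id_or_conj_of_continuous hf

/-- **Definition 3.1 (i)** (FrdII p. 23): "If `K`, `L` are archimedean local fields, then any inclusion
of topological rings `ι : K ↪ L` is either an isomorphism or satisfies the property that there exist
isomorphisms of topological fields `α_K : K ≃ ℝ`, `α_L : L ≃ ℂ` such that `α_L ∘ ι ∘ α_K⁻¹ : ℝ ↪ ℂ`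
is the natural inclusion." [cite: MochizukiFrdII2008, Def 3.1 (i) p.23] -/
def InclusionDichotomy : Prop :=
  ∀ (K L : Type) [Field K] [TopologicalSpace K] [Field L] [TopologicalSpace L],
    IsArchLocalField K → IsArchLocalField L → ∀ ι : K →+* L, Continuous ι →
      (∃ e : K ≃+* L, Continuous e ∧ Continuous e.symm ∧ ∀ x, e x = ι x) ∨
        ∃ (αK : K ≃+* ℝ) (αL : L ≃+* ℂ), Continuous αK ∧ Continuous αK.symm ∧ Continuous αL ∧
          Continuous αL.symm ∧ ∀ x : ℝ, αL (ι (αK.symm x)) = (x : ℂ)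

end LocalField

/-! ### Definition 3.1 (ii): units, `ord(K^×)`, the canonical decomposition -/

section Units

variable (K : Type*) [RCLike K]

/-- **Definition 3.1 (ii)** (FrdII p. 23): `O_K^× ⊆ K^×`, "the group of units of `K`, the topological
subgroup of `K^×` of elements of norm `1`". [cite: MochizukiFrdII2008, Def 3.1 (ii) p.23] -/
def normOneSubgroup : Subgroup Kˣ where
  carrier := {u | ‖(u : K)‖ = 1}
  mul_mem' {a b} ha hb := by
    simp only [mem_setOf_eq, Units.val_mul, norm_mul] at *
    rw [ha, hb, mul_one]
  one_mem' := by simp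
  inv_mem' {a} ha := by
    simp only [mem_setOf_eq, Units.val_inv_eq_inv_val, norm_inv] at *
    rw [ha, inv_one]

/-- Membership in `O_K^×`: norm one. [cite: MochizukiFrdII2008, Def 3.1 (ii) p.23] -/
theorem mem_normOneSubgroup_iff (u : Kˣ) : u ∈ normOneSubgroup K ↔ ‖(u : K)‖ = 1 := Iff.rfl

/-- `S¹ := O_ℂ^×` (FrdII Def. 3.1 (ii), p. 23): an element of Mathlib's `Circle` is a unit of `ℂ` of
norm one. [cite: MochizukiFrdII2008, Def 3.1 (ii) p.23] -/
theorem circle_toUnits_mem (z : Circle) : Circle.toUnits z ∈ normOneSubgroup ℂ := by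
  rw [mem_normOneSubgroup_iff]
  exact z.norm_coe

/-- `ord(K^×) := K^×/O_K^×` (FrdII Def. 3.1 (ii), p. 23). [cite: MochizukiFrdII2008, Def 3.1 (ii) p.23] -/
abbrev OrdArch : Type _ := Kˣ ⧸ normOneSubgroup K

/-- `ℝ_{>0}` as a multiplicative group. [cite: MochizukiFrdII2008, Def 3.1 (ii) p.23] -/
abbrev PosReal : Type := {x : ℝ // 0 < x}

/-- The absolute value `K^× → ℝ_{>0}`. [cite: MochizukiFrdII2008, Def 3.1 (ii) p.23] -/
def absHom : Kˣ →* PosReal where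
  toFun u := ⟨‖(u : K)‖, norm_pos_iff.mpr u.ne_zero⟩
  map_one' := Subtype.ext (by simp)
  map_mul' a b := Subtype.ext (by simp)

/-- The value of `absHom`. [cite: MochizukiFrdII2008, Def 3.1 (ii) p.23] -/
@[simp] theorem coe_absHom (u : Kˣ) : (absHom K u : ℝ) = ‖(u : K)‖ := rfl

/-- The kernel of `|·| : K^× → ℝ_{>0}` is `O_K^×`. [cite: MochizukiFrdII2008, Def 3.1 (ii) p.23] -/
theorem ker_absHom : (absHom K).ker = normOneSubgroup K := by
  ext u
  rw [MonoidHom.mem_ker, mem_normOneSubgroup_iff, Subtype.ext_iff, coe_absHom]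
  rfl

/-- A positive real as a unit of `K` (the section `λ ↦ λ ∈ K^×` implicit in "`z · λ ∈ K^×`", p. 24).
[cite: MochizukiFrdII2008, Def 3.1 (ii) pp.23-24] -/
def ofPosReal : PosReal →* Kˣ where
  toFun x := Units.mk0 ((x.1 : ℝ) : K) (by exact_mod_cast x.2.ne')
  map_one' := Units.ext (by simp)
  map_mul' a b := Units.ext (by simp [Positive.val_mul])

/-- The value of `ofPosReal`. [cite: MochizukiFrdII2008, Def 3.1 (ii) pp.23-24] -/
@[simp] theorem coe_ofPosReal (x : PosReal) : (ofPosReal K x : K) = ((x.1 : ℝ) : K) := rfl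

/-- `|λ| = λ` for `λ ∈ ℝ_{>0} ⊆ K^×`. [cite: MochizukiFrdII2008, Def 3.1 (ii) pp.23-24] -/
@[simp] theorem absHom_ofPosReal (x : PosReal) : absHom K (ofPosReal K x) = x :=
  Subtype.ext (by simp [abs_of_pos x.2])

/-- `|·| : K^× → ℝ_{>0}` is surjective. [cite: MochizukiFrdII2008, Def 3.1 (ii) p.23] -/
theorem absHom_surjective : Surjective (absHom K) := fun x => ⟨ofPosReal K x, absHom_ofPosReal K x⟩

/-- **Definition 3.1 (ii)** (FrdII p. 23): "the usual absolute value `|−|` on `K` determines a natural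
isomorphism `ord(K^×) ≃ ℝ_{>0}`" — PROVED. [cite: MochizukiFrdII2008, Def 3.1 (ii) p.23] -/
def ordArchEquiv : OrdArch K ≃* PosReal :=
  (QuotientGroup.quotientMulEquivOfEq (ker_absHom K).symm).trans
    (QuotientGroup.quotientKerEquivOfSurjective _ (absHom_surjective K))

/-- The unit part `u/|u| ∈ O_K^×` of `u ∈ K^×`. [cite: MochizukiFrdII2008, Def 3.1 (ii) pp.23-24] -/
def unitPart (u : Kˣ) : normOneSubgroup K :=
  ⟨u * (ofPosReal K (absHom K u))⁻¹, by
    rw [mem_normOneSubgroup_iff, Units.val_mul, Units.val_inv_eq_inv_val, coe_ofPosReal, coe_absHom,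
      norm_mul, norm_inv, RCLike.norm_ofReal, abs_of_pos (norm_pos_iff.mpr u.ne_zero),
      mul_inv_cancel₀ (norm_ne_zero_iff.mpr u.ne_zero)]⟩

/-- **Definition 3.1 (ii)** (FrdII pp. 23–24): "we have a canonical decomposition
`O_K^× × ord(K^×) ≃ K^×` [i.e., given by mapping a pair `(z, λ)`, where `z ∈ O_K^×`,
`λ ∈ ℝ_{>0} ≅ ord(K^×)`, to `z · λ ∈ K^×`]" — PROVED to be a group isomorphism (polar decomposition).
[cite: MochizukiFrdII2008, Def 3.1 (ii) pp.23-24] -/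
def unitDecomposition : normOneSubgroup K × PosReal ≃* Kˣ where
  toFun p := (p.1 : Kˣ) * ofPosReal K p.2
  invFun u := (unitPart K u, absHom K u)
  left_inv p := by
    obtain ⟨z, x⟩ := p
    have hz : absHom K (z : Kˣ) = 1 := by rw [← MonoidHom.mem_ker, ker_absHom]; exact z.2
    have habs : absHom K ((z : Kˣ) * ofPosReal K x) = x := by rw [map_mul, hz, one_mul, absHom_ofPosReal]
    refine Prod.ext (Subtype.ext ?_) habs
    change (z : Kˣ) * ofPosReal K x * (ofPosReal K (absHom K ((z : Kˣ) * ofPosReal K x)))⁻¹ = z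
    rw [habs, mul_inv_cancel_right]
  right_inv u := by
    change u * (ofPosReal K (absHom K u))⁻¹ * ofPosReal K (absHom K u) = u
    rw [inv_mul_cancel_right]
  map_mul' p q := by
    change (p.1 : Kˣ) * q.1 * ofPosReal K (p.2 * q.2) = (p.1 : Kˣ) * ofPosReal K p.2 * (q.1 * ofPosReal K q.2)
    rw [map_mul]
    simp only [mul_assoc, mul_left_comm (q.1 : Kˣ)]

end Units

/-! ### Definition 3.1 (iii): angular regions -/

section Angular

variable (K : Type*) [RCLike K]

/-- **Definition 3.1 (iii)** (FrdII p. 24): an *angular region* `A ⊆ K^×`, "any subset of the form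
`B × C` [relative to the canonical decomposition of (ii)], where `B ⊆ O_K^×` is an open subset whose
intersection with each connected component of `O_K^×` is [nonempty and] connected …, and
`C ⊆ ord(K^×) ≅ ℝ_{>0}` is an interval of the form `(0, λ]`, where `λ ∈ ℝ_{>0}`" — recorded as the data
`(B, λ)`; "we shall refer to `λ` as the *tip*". [cite: MochizukiFrdII2008, Def 3.1 (iii) p.24] -/
structure AngularRegion where
  /-- the angular part `B ⊆ O_K^×` -/
  dir : Set (normOneSubgroup K)
  /-- the tip `λ > 0` -/
  tip : PosReal
  /-- `B` is open -/
  isOpen_dir : IsOpen dir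
  /-- `B` meets every connected component of `O_K^×` in a nonempty connected set -/
  isConnected_inter : ∀ z : normOneSubgroup K, IsConnected (dir ∩ connectedComponent z)

namespace AngularRegion

variable {K}

/-- The subset `A = B × (0, λ] ⊆ K^×` of an angular region (FrdII Def. 3.1 (iii), p. 24).
[cite: MochizukiFrdII2008, Def 3.1 (iii) p.24] -/
def carrier (A : AngularRegion K) : Set Kˣ := {u | unitPart K u ∈ A.dir ∧ absHom K u ≤ A.tip}

/-- "the subset `∂A := {a ∈ A | |a| = λ} ⊆ A`, the *boundary* of `A`" (FrdII Def. 3.1 (iii), p. 24).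
[cite: MochizukiFrdII2008, Def 3.1 (iii) p.24] -/
def boundary (A : AngularRegion K) : Set Kˣ := {u | u ∈ A.carrier ∧ absHom K u = A.tip}

/-- The boundary is contained in the region. [cite: MochizukiFrdII2008, Def 3.1 (iii) p.24] -/
theorem boundary_subset (A : AngularRegion K) : A.boundary ⊆ A.carrier := fun _ h => h.1

/-- "[so `∂A` maps bijectively via the projection `K^× → O_K^×` to `B`]" (FrdII Def. 3.1 (iii), p. 24) —
PROVED. [cite: MochizukiFrdII2008, Def 3.1 (iii) p.24] -/
theorem bijOn_unitPart_boundary (A : AngularRegion K) : BijOn (unitPart K) A.boundary A.dir := by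
  have key : ∀ (z : normOneSubgroup K) (x : PosReal),
      unitPart K ((z : Kˣ) * ofPosReal K x) = z ∧ absHom K ((z : Kˣ) * ofPosReal K x) = x := by
    intro z x
    have e := Prod.ext_iff.mp ((unitDecomposition K).symm_apply_apply (z, x))
    exact ⟨e.1, e.2⟩
  refine ⟨fun u hu => hu.1.1, fun u hu v hv h => ?_, fun z hz => ?_⟩
  · -- same unit part and same absolute value `λ`
    have hu' : ((unitPart K u : Kˣ)) * ofPosReal K (absHom K u) = u :=
      (unitDecomposition K).apply_symm_apply u
    have hv' : ((unitPart K v : Kˣ)) * ofPosReal K (absHom K v) = v :=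
      (unitDecomposition K).apply_symm_apply v
    rw [← hu', ← hv', h, hu.2, hv.2]
  · obtain ⟨h1, h2⟩ := key z A.tip
    exact ⟨(z : Kˣ) * ofPosReal K A.tip, ⟨⟨by rw [h1]; exact hz, by rw [h2]⟩, h2⟩, h1⟩

/-- "if `B = O_K^×`, then we shall refer to the angular region `A` as *isotropic*"
(FrdII Def. 3.1 (iii), p. 24). [cite: MochizukiFrdII2008, Def 3.1 (iii) p.24] -/
def IsIsotropic (A : AngularRegion K) : Prop := A.dir = univ

/-- "we shall refer to `A`, `A′` as *co-angular* if the projections of `A`, `A′` to `O_K^×` coincide"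
(FrdII Def. 3.1 (iii), p. 24). [cite: MochizukiFrdII2008, Def 3.1 (iii) p.24] -/
def CoAngular (A A' : AngularRegion K) : Prop := A.dir = A'.dir

/-- Co-angularity is an equivalence relation (reflexive case). [cite: MochizukiFrdII2008, Def 3.1 (iii) p.24] -/
theorem CoAngular.refl (A : AngularRegion K) : CoAngular A A := rfl

/-- Isotropic angular regions are pairwise co-angular. [cite: MochizukiFrdII2008, Def 3.1 (iii) p.24] -/
theorem IsIsotropic.coAngular {A A' : AngularRegion K} (h : A.IsIsotropic) (h' : A'.IsIsotropic) :
    CoAngular A A' := h.trans h'.symm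

/-- The isotropic angular region with tip `λ` ("`B = O_K^×`"). [cite: MochizukiFrdII2008, Def 3.1 (iii) p.24] -/
def isotropicOfTip (t : PosReal) : AngularRegion K where
  dir := univ
  tip := t
  isOpen_dir := isOpen_univ
  isConnected_inter z := by rw [univ_inter]; exact isConnected_connectedComponent

/-- `isotropicOfTip t` is isotropic. [cite: MochizukiFrdII2008, Def 3.1 (iii) p.24] -/
theorem isIsotropic_isotropicOfTip (t : PosReal) : (isotropicOfTip (K := K) t).IsIsotropic := rfl

/-- "[which implies that `B = O_K^×` whenever `K` is real]" (FrdII Def. 3.1 (iii), p. 24): if `O_K^×`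
is totally disconnected (as `O_ℝ^× = {±1}` is), every angular region is isotropic — PROVED: each
component is a point, which `B` must meet. [cite: MochizukiFrdII2008, Def 3.1 (iii) p.24] -/
theorem isIsotropic_of_totallyDisconnected [TotallyDisconnectedSpace (normOneSubgroup K)]
    (A : AngularRegion K) : A.IsIsotropic := by
  refine eq_univ_of_forall fun z => ?_
  obtain ⟨w, hwB, hwz⟩ := (A.isConnected_inter z).nonempty
  rw [connectedComponent_eq_singleton, mem_singleton_iff] at hwz
  exact hwz ▸ hwB

/-- **Definition 3.1 (iii)** (FrdII p. 24): "We shall refer to a subset of `K` as an *angular region* if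
it is the union with the subset `{0}` of an angular region of `K^×`."
[cite: MochizukiFrdII2008, Def 3.1 (iii) p.24] -/
def carrierWithZero (A : AngularRegion K) : Set K := insert 0 ((fun u : Kˣ => (u : K)) '' A.carrier)

end AngularRegion

/-- **Definition 3.1 (iii)** (FrdII p. 24): for a one-dimensional `K`-vector space `V`, "it makes sense
to speak of angular regions … of `V`, `V^×`" (`V^× := V \ {0}`, `ord(V) := V^×/O_K^×`): a subset of
`V^×` is an angular region if it corresponds to one of `K^×` under a (equivalently, any) linear
isomorphism `V ≃ K` — the notion is invariant under `K^×`. [cite: MochizukiFrdII2008, Def 3.1 (iii) p.24] -/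
def IsAngularRegionOf (V : Type*) [AddCommGroup V] [Module K V] (S : Set V) : Prop :=
  ∃ (e : V ≃ₗ[K] K) (A : AngularRegion K), S = {v | ∃ u ∈ A.carrier, e v = (u : K)}

/-- **Definition 3.1 (iii)**, last sentence (FrdII p. 24): for angular regions `Aᵢ ⊆ Vᵢ` of
one-dimensional spaces, "`A₁ ⊗_K A₂ := {a₁ ⊗ a₂ | a₁ ∈ A₁, a₂ ∈ A₂} ⊆ V₁ ⊗_K V₂` is an angular region of
`V₁ ⊗_K V₂`" — here for `Vᵢ = K` (so `V₁ ⊗ V₂ = K` and `a₁ ⊗ a₂ = a₁ a₂`): the product set of two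
angular regions of `K^×` is an angular region. [cite: MochizukiFrdII2008, Def 3.1 (iii) p.24] -/
def TensorOfAngularRegions : Prop :=
  ∀ A₁ A₂ : AngularRegion K, ∃ A : AngularRegion K, A.carrier = A₁.carrier * A₂.carrier

/-! ### Definition 3.1 (iv): base change along `ℝ ↪ ℂ` -/

/-- **Definition 3.1 (iv)** (FrdII p. 24), the non-isomorphic case `ι : ℝ ↪ ℂ`: `(V_K, A_K)|_L := (V_L, A_L)`
with `V_L := V_K ⊗_K L` and `A_L` "the [necessarily isotropic] angular region of `V_L` given by the
`O_L^×`-orbit of the image of `A_K`" — for `V_K = ℝ`: the isotropic angular region of `ℂ^×` with the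
same tip. (Along an isomorphism `ι`, `A_L` is the image of `A_K`.)
[cite: MochizukiFrdII2008, Def 3.1 (iv) p.24] -/
def AngularRegion.baseChangeToComplex (A : AngularRegion ℝ) : AngularRegion ℂ :=
  AngularRegion.isotropicOfTip A.tip

/-- The base change to `ℂ` is isotropic ("[necessarily isotropic]", FrdII Def. 3.1 (iv), p. 24).
[cite: MochizukiFrdII2008, Def 3.1 (iv) p.24] -/
theorem AngularRegion.isIsotropic_baseChangeToComplex (A : AngularRegion ℝ) :
    A.baseChangeToComplex.IsIsotropic := rfl

end Angular

end ArchFrd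

end

end Literature.AlgebraicGeometry.Frobenioids
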